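import Literature.Computability.Complexity.CHIterProd
import Literature.Computability.Complexity.CHPrimeCounting
import HarnessLib

/-!
# Residues of the prime blocks, their cofactors and their half-successors inside `CH`

Toolkit file (theorems only) of the scaled-up `FOM + MAJ` calculus: the Chinese remainder
representations of the auxiliary numbers of Hesse–Allender–Barrington's conversion from CRR to
binary (JCSS 65 (2002), §4, proof of Thm. 4.1 and Lemma 4.3), obtained from the iterated-product
rule `CHIterProd.iterProdModGraph_mem_CH` ("by adding the discrete logs") and the block predicates
of `CHPrimeCounting.lean`. With `L = t(|w|)`, `K' = 2^{L+2}`, the `b`-th block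
`A_b = ∏ {q prime | b K' ≤ π'(q) < (b+1) K'}` (`1 ≤ b ≤ 2^{L+1}`) and the base
`P = {q prime | K' ≤ π'(q) < K'(2^{L+1}+1)}` (so `∏ P = ∏_b A_b`):

* `blockResGraph_mem_CH` / `blockRes_eq`: `⟨⟨w, bin b⟩, μ⟩ ↦ A_b mod val μ`;
* `cofactorResGraph_mem_CH` / `cofactorRes_eq`: `⟨⟨w, x⟩, μ⟩ ↦ (∏_{q ∈ P, q ≠ val x} q) mod val μ`
  (the cofactor `C_q/2` of HAB's `hᵢ = Cᵢ⁻¹ mod mᵢ`);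
* `halfSuccResGraph_mem_CH` / `halfSuccRes_eq`: `⟨⟨w, x⟩, μ⟩ ↦ (∏_b (A_b+1)/2) mod val μ` at `μ = x`
  (HAB Thm. 4.1: "we can compute the integer `(1 + Aᵢ)/2` in `CRR_P`"), each factor being
  `((A_b mod q) + 1)·(q+1)/2 ≡ (A_b+1)/2 (mod q)`.

All for prime moduli (value `0` otherwise, the convention of the product rule). No new definitions.

## References

* W. Hesse, E. Allender, D. A. M. Barrington, JCSS 65 (2002), §4 (Lemma 4.3, Thm. 4.1).
* P. Bürgisser, ECCC TR06-113 (2006), Thm. 3.4, Thm. 3.7.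
-/

namespace Literature.Computability.Complexity

open _root_.Computability Polynomial PRelSigma TTClosure Brick PPSharpP ThresholdPP Plumb Finset

section Blocks

variable (t : Polynomial ℕ)

/-! ### Readers and small atoms -/

/-- The reader `r ↦ val (sndP r)` has a `CH` graph. [folklore] -/
theorem sndValGraph_mem_CH : {z | bitsToNat (sndP (fstP z)) = bitsToNat (sndP z)} ∈ CH :=
  mem_CH_of_iff (P_subset_CH (preimage_mem_P eqVal_mem_P (pairFn_mem_FP (comp_mem_FP sndP_mem_FP fstP_mem_FP) sndP_mem_FP)))
    _ fun z => by
      change _ ↔ bitsToNat (fstP (pairFn (sndP ∘ fstP) sndP z)) = bitsToNat (sndP (pairFn (sndP ∘ fstP) sndP z))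
      rw [pairFn_apply, fstP_boolPair, sndP_boolPair]; rfl

/-- A factor that is either `val (sndP r)` or `1` is `< 2^{|r|+1}`. [folklore] -/
theorem ite_sndVal_one_lt (Q : List Bool → Prop) [DecidablePred Q] (r : List Bool) :
    (if Q r then bitsToNat (sndP r) else 1) < 2 ^ (X + 1 : Polynomial ℕ).eval r.length := by
  rw [eval_add, eval_X, eval_one, pow_succ]
  have h1 : bitsToNat (sndP r) < 2 ^ r.length := (bitsToNat_lt _).trans_le (Nat.pow_le_pow_right (by norm_num) (by
    have a := length_fstF_sndF_le r; change 2 * (fstP r).length + (sndP r).length ≤ _ at a; omega))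
  have h2 : 1 ≤ 2 ^ r.length := Nat.one_le_two_pow
  split_ifs <;> omega

/-- Monotonicity of the search range: `2^{4t(|w|)+11} ≤ 2^{(4t+11)(|u|)}` for `|w| ≤ |u|`. [folklore] -/
theorem searchBound_le {w u : List Bool} (h : w.length ≤ u.length) :
    2 ^ (4 * t.eval w.length + 11) ≤ 2 ^ (4 * t + 11 : Polynomial ℕ).eval u.length := by
  refine Nat.pow_le_pow_right (by norm_num) ?_
  simp only [eval_add, eval_mul, eval_ofNat]
  have := TM2Iter.eval_mono t h
  omega

/-- **Enough primes below the search range**: `(b+1) K' ≤ π'(2^{(4t+11)(|u|)})` for `b ≤ 2^{L+1}`,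
`K' = 2^{L+2}`, `L = t(|w|)`, `|w| ≤ |u|`. [cite: HesseAllenderBarrington2002, Theorem 4.1] -/
theorem blockRange_le_primeCounting' {w u : List Bool} (h : w.length ≤ u.length) {b : ℕ} (hb : b ≤ 2 ^ (t.eval w.length + 1)) :
    (b + 1) * 2 ^ (t.eval w.length + 2) ≤ Nat.primeCounting' (2 ^ (4 * t + 11 : Polynomial ℕ).eval u.length) :=
  calc (b + 1) * 2 ^ (t.eval w.length + 2) ≤ (2 ^ (t.eval w.length + 1) + 1) * 2 ^ (t.eval w.length + 2) :=
        Nat.mul_le_mul_right _ (by omega)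
    _ = 2 ^ (t.eval w.length + 2) * (2 ^ (t.eval w.length + 1) + 1) := mul_comm _ _
    _ ≤ 2 ^ (2 * t.eval w.length + 4) := blockRange_le_two_pow _
    _ ≤ Nat.primeCounting' (2 ^ (4 * t.eval w.length + 11)) := two_pow_le_primeCounting' _
    _ ≤ Nat.primeCounting' (2 ^ (4 * t + 11 : Polynomial ℕ).eval u.length) := Nat.monotone_primeCounting' (searchBound_le t h)

/-! ### Residues of the blocks `A_b` -/

/-- **The block factor family has a `CH` graph**: on `r = ⟨⟨w, bin b⟩, x⟩`, the factor is `val x` if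
`val x` is a prime of the `b`-th block and `1` otherwise. [cite: HesseAllenderBarrington2002, Theorem 4.1] -/
theorem idxBlockFactorGraph_mem_CH :
    {z | (fun r => if (bitsToNat (sndP r)).Prime ∧
          bitsToNat (sndP (fstP r)) * 2 ^ (t.eval (fstP (fstP r)).length + 2) ≤ Nat.primeCounting' (bitsToNat (sndP r)) ∧
          Nat.primeCounting' (bitsToNat (sndP r)) < (bitsToNat (sndP (fstP r)) + 1) * 2 ^ (t.eval (fstP (fstP r)).length + 2)
        then bitsToNat (sndP r) else 1) (fstP z) = bitsToNat (sndP z)} ∈ CH :=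
  iteGraph_mem_CH' (blockIdx_mem_CH t) (f := fun r => bitsToNat (sndP r)) (g := fun _ => 1) sndValGraph_mem_CH (constGraph_mem_CH 1)

/-- Bit-size of an iterated-product residue: below the modulus or `0`, hence `< 2^{|u|}`. [folklore] -/
theorem iteModRes_lt_two_pow (F : List Bool → ℕ) (u : List Bool) :
    (if (bitsToNat (sndP u)).Prime then F u % bitsToNat (sndP u) else 0) < 2 ^ (X : Polynomial ℕ).eval u.length := by
  split_ifs with h
  · rw [eval_X]
    refine (Nat.mod_lt _ h.pos).trans ((bitsToNat_lt _).trans_le (Nat.pow_le_pow_right (by norm_num) ?_))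
    have a := length_fstF_sndF_le u
    change 2 * (fstP u).length + (sndP u).length ≤ _ at a
    omega
  · exact Nat.two_pow_pos _

/-- **The residues of the blocks are `CH`-definable** (iterated-product rule over the block factor
family, search range `2^{(4t+11)|u|}`): there is a function `A` on records `⟨⟨w, bin b⟩, μ⟩` with a `CH`
graph, below `2^{|·|}`, such that `A ⟨⟨w, bin b⟩, μ⟩ = A_b mod val μ` for prime `val μ` and `b ≤ 2^{L+1}`,
where `A_b = ∏ {q prime | b K' ≤ π'(q) < (b+1) K'}`, `K' = 2^{L+2}`, `L = t(|w|)` (HAB 2002, proof of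
Thm. 4.1, "compute `X` in `CRR_P`" for the blocks `Aᵢ`). [cite: HesseAllenderBarrington2002, Theorem 4.1] -/
theorem exists_blockRes :
    ∃ A : List Bool → ℕ, {z | A (fstP z) = bitsToNat (sndP z)} ∈ CH ∧ (∀ u, A u < 2 ^ (X : Polynomial ℕ).eval u.length) ∧
      ∀ (w μ : List Bool) (b : ℕ), b ≤ 2 ^ (t.eval w.length + 1) → (bitsToNat μ).Prime →
        A (boolPair (boolPair w (encodeNat b)) μ) =
          (∏ q ∈ (Ico (b * 2 ^ (t.eval w.length + 2)) ((b + 1) * 2 ^ (t.eval w.length + 2))).image (Nat.nth Nat.Prime), q) % bitsToNat μ := by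
  refine ⟨fun u => if (bitsToNat (sndP u)).Prime then
      (∏ k ∈ range (2 ^ (4 * t + 11 : Polynomial ℕ).eval (fstP u).length),
        (fun r => if (bitsToNat (sndP r)).Prime ∧
            bitsToNat (sndP (fstP r)) * 2 ^ (t.eval (fstP (fstP r)).length + 2) ≤ Nat.primeCounting' (bitsToNat (sndP r)) ∧
            Nat.primeCounting' (bitsToNat (sndP r)) < (bitsToNat (sndP (fstP r)) + 1) * 2 ^ (t.eval (fstP (fstP r)).length + 2)
          then bitsToNat (sndP r) else 1) (boolPair (fstP u) (encodeNat k))) % bitsToNat (sndP u) else 0,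
    iterProdModGraph_mem_CH (4 * t + 11)
      (a := fun r => if (bitsToNat (sndP r)).Prime ∧
            bitsToNat (sndP (fstP r)) * 2 ^ (t.eval (fstP (fstP r)).length + 2) ≤ Nat.primeCounting' (bitsToNat (sndP r)) ∧
            Nat.primeCounting' (bitsToNat (sndP r)) < (bitsToNat (sndP (fstP r)) + 1) * 2 ^ (t.eval (fstP (fstP r)).length + 2)
          then bitsToNat (sndP r) else 1)
      (idxBlockFactorGraph_mem_CH t) (ite_sndVal_one_lt _),
    fun u => iteModRes_lt_two_pow (fun u => ∏ k ∈ range (2 ^ (4 * t + 11 : Polynomial ℕ).eval (fstP u).length),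
        (fun r => if (bitsToNat (sndP r)).Prime ∧
            bitsToNat (sndP (fstP r)) * 2 ^ (t.eval (fstP (fstP r)).length + 2) ≤ Nat.primeCounting' (bitsToNat (sndP r)) ∧
            Nat.primeCounting' (bitsToNat (sndP r)) < (bitsToNat (sndP (fstP r)) + 1) * 2 ^ (t.eval (fstP (fstP r)).length + 2)
          then bitsToNat (sndP r) else 1) (boolPair (fstP u) (encodeNat k))) u, fun w μ b hb hμ => ?_⟩
  simp only [fstP_boolPair, sndP_boolPair, bitsToNat_encodeNat]
  rw [if_pos hμ, ← prod_filter, filter_range_eq_image_nth]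
  exact blockRange_le_primeCounting' t (by rw [length_boolPair]; omega) hb

/-! ### Residues of the cofactors -/

/-- The base-prime predicate read on `⟨⟨w, x⟩, bin k⟩` (for the prime `k`): a `CH` language. [cite: HesseAllenderBarrington2002, Theorem 4.1] -/
theorem basePrimeThird_mem_CH :
    ({r | (bitsToNat (sndP r)).Prime ∧ 2 ^ (t.eval (fstP (fstP r)).length + 2) ≤ Nat.primeCounting' (bitsToNat (sndP r)) ∧
        Nat.primeCounting' (bitsToNat (sndP r)) < 2 ^ (t.eval (fstP (fstP r)).length + 2) * (2 ^ (t.eval (fstP (fstP r)).length + 1) + 1)} :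
      Language Bool) ∈ CH :=
  mem_CH_of_iff (preimage_mem_CH (blockPrime_mem_CH t) (pairFn_mem_FP (comp_mem_FP fstP_mem_FP fstP_mem_FP) sndP_mem_FP)) _
    fun r => by
      change _ ↔ pairFn (fstP ∘ fstP) sndP r ∈ ({r | (bitsToNat (sndP r)).Prime ∧
        2 ^ (t.eval (fstP r).length + 2) ≤ Nat.primeCounting' (bitsToNat (sndP r)) ∧
        Nat.primeCounting' (bitsToNat (sndP r)) < 2 ^ (t.eval (fstP r).length + 2) * (2 ^ (t.eval (fstP r).length + 1) + 1)} : Language Bool)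
      rw [pairFn_apply]
      change _ ↔ (bitsToNat (sndP (boolPair ((fstP ∘ fstP) r) (sndP r)))).Prime ∧ _ ∧ _
      simp only [Function.comp_apply, fstP_boolPair, sndP_boolPair]
      exact Iff.rfl

/-- **The cofactor factor family has a `CH` graph**: on `r = ⟨⟨w, x⟩, bin k⟩`, the factor is `k` if `k`
is a base prime different from `val x`, and `1` otherwise. [cite: HesseAllenderBarrington2002, Lemma 4.3] -/
theorem cofactorFactorGraph_mem_CH :
    {z | (fun r => if ((bitsToNat (sndP r)).Prime ∧ 2 ^ (t.eval (fstP (fstP r)).length + 2) ≤ Nat.primeCounting' (bitsToNat (sndP r)) ∧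
            Nat.primeCounting' (bitsToNat (sndP r)) < 2 ^ (t.eval (fstP (fstP r)).length + 2) * (2 ^ (t.eval (fstP (fstP r)).length + 1) + 1)) ∧
          ¬ bitsToNat (sndP r) = bitsToNat (sndP (fstP r))
        then bitsToNat (sndP r) else 1) (fstP z) = bitsToNat (sndP z)} ∈ CH := by
  have hNe : ({r | ¬ bitsToNat (sndP r) = bitsToNat (sndP (fstP r))} : Language Bool) ∈ Classes.P := by
    refine mem_P_of_iff ((compl_mem_P_iff).2 (preimage_mem_P eqVal_mem_P (pairFn_mem_FP sndP_mem_FP (comp_mem_FP sndP_mem_FP fstP_mem_FP))))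
      _ fun r => ?_
    rw [memL_compl]
    change _ ↔ ¬ bitsToNat (fstP (pairFn sndP (sndP ∘ fstP) r)) = bitsToNat (sndP (pairFn sndP (sndP ∘ fstP) r))
    rw [pairFn_apply, fstP_boolPair, sndP_boolPair]; rfl
  have hQ := mem_CH_of_iff (inter_mem_CH (basePrimeThird_mem_CH t) (P_subset_CH hNe))
    ({r | ((bitsToNat (sndP r)).Prime ∧ 2 ^ (t.eval (fstP (fstP r)).length + 2) ≤ Nat.primeCounting' (bitsToNat (sndP r)) ∧
        Nat.primeCounting' (bitsToNat (sndP r)) < 2 ^ (t.eval (fstP (fstP r)).length + 2) * (2 ^ (t.eval (fstP (fstP r)).length + 1) + 1)) ∧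
      ¬ bitsToNat (sndP r) = bitsToNat (sndP (fstP r))} : Language Bool) fun r => by rw [memL_inf']; exact Iff.rfl
  exact iteGraph_mem_CH' hQ (f := fun r => bitsToNat (sndP r)) (g := fun _ => 1) sndValGraph_mem_CH (constGraph_mem_CH 1)

/-- **The residues of the cofactors are `CH`-definable**: there is a function `C` on records
`⟨⟨w, x⟩, μ⟩` with a `CH` graph, below `2^{|·|}`, such that for prime `val μ`,
`C ⟨⟨w, x⟩, μ⟩ = (∏_{q ∈ P, q ≠ val x} q) mod val μ` with the base `P = {q prime | K' ≤ π'(q) < K'(2^{L+1}+1)}`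
(HAB Lemma 4.3: "`Cᵢ mod mᵢ` can be computed by adding the discrete logs of the `mⱼ` for `j ≠ i`"). [cite: HesseAllenderBarrington2002, Lemma 4.3] -/
theorem exists_cofactorRes :
    ∃ C : List Bool → ℕ, {z | C (fstP z) = bitsToNat (sndP z)} ∈ CH ∧ (∀ u, C u < 2 ^ (X : Polynomial ℕ).eval u.length) ∧
      ∀ (w x μ : List Bool), (bitsToNat μ).Prime →
        C (boolPair (boolPair w x) μ) =
          (∏ q ∈ ((Ico (2 ^ (t.eval w.length + 2)) (2 ^ (t.eval w.length + 2) * (2 ^ (t.eval w.length + 1) + 1))).image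
            (Nat.nth Nat.Prime)).erase (bitsToNat x), q) % bitsToNat μ := by
  refine ⟨fun u => if (bitsToNat (sndP u)).Prime then
      (∏ k ∈ range (2 ^ (4 * t + 11 : Polynomial ℕ).eval (fstP u).length),
        (fun r => if ((bitsToNat (sndP r)).Prime ∧ 2 ^ (t.eval (fstP (fstP r)).length + 2) ≤ Nat.primeCounting' (bitsToNat (sndP r)) ∧
              Nat.primeCounting' (bitsToNat (sndP r)) < 2 ^ (t.eval (fstP (fstP r)).length + 2) * (2 ^ (t.eval (fstP (fstP r)).length + 1) + 1)) ∧
            ¬ bitsToNat (sndP r) = bitsToNat (sndP (fstP r))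
          then bitsToNat (sndP r) else 1) (boolPair (fstP u) (encodeNat k))) % bitsToNat (sndP u) else 0,
    iterProdModGraph_mem_CH (4 * t + 11)
      (a := fun r => if ((bitsToNat (sndP r)).Prime ∧ 2 ^ (t.eval (fstP (fstP r)).length + 2) ≤ Nat.primeCounting' (bitsToNat (sndP r)) ∧
              Nat.primeCounting' (bitsToNat (sndP r)) < 2 ^ (t.eval (fstP (fstP r)).length + 2) * (2 ^ (t.eval (fstP (fstP r)).length + 1) + 1)) ∧
            ¬ bitsToNat (sndP r) = bitsToNat (sndP (fstP r))
          then bitsToNat (sndP r) else 1)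
      (cofactorFactorGraph_mem_CH t) (ite_sndVal_one_lt _),
    fun u => iteModRes_lt_two_pow (fun u => ∏ k ∈ range (2 ^ (4 * t + 11 : Polynomial ℕ).eval (fstP u).length),
        (fun r => if ((bitsToNat (sndP r)).Prime ∧ 2 ^ (t.eval (fstP (fstP r)).length + 2) ≤ Nat.primeCounting' (bitsToNat (sndP r)) ∧
              Nat.primeCounting' (bitsToNat (sndP r)) < 2 ^ (t.eval (fstP (fstP r)).length + 2) * (2 ^ (t.eval (fstP (fstP r)).length + 1) + 1)) ∧
            ¬ bitsToNat (sndP r) = bitsToNat (sndP (fstP r))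
          then bitsToNat (sndP r) else 1) (boolPair (fstP u) (encodeNat k))) u, fun w x μ hμ => ?_⟩
  simp only [fstP_boolPair, sndP_boolPair, bitsToNat_encodeNat]
  rw [if_pos hμ, ← prod_filter, ← filter_filter, filter_range_eq_image_nth, filter_ne']
  have := blockRange_le_primeCounting' t (show w.length ≤ (boolPair w x).length by rw [length_boolPair]; omega) le_rfl
  rwa [mul_comm] at this

/-! ### Residues of the half-successor product `∏_b (A_b + 1)/2` -/

/-- The binary operation `(a, m) ↦ ((a + 1) · ((m + 1)/2)) mod m` has a graph in `P`. [folklore] -/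
theorem halfSuccOpGraph_mem_P :
    ({u | (bitsToNat (fstP (fstP u)) + 1) * ((bitsToNat (sndP (fstP u)) + 1) / 2) % bitsToNat (sndP (fstP u)) = bitsToNat (sndP u)} :
      Language Bool) ∈ Classes.P :=
  mem_P_of_iff (graphFP_mem_P (comp_mem_FP remFn_mem_FP (pairFn_mem_FP (comp_mem_FP prodFn_mem_FP (pairFn_mem_FP
    (comp_mem_FP addFn_mem_FP (pairFn_mem_FP fstP_mem_FP (const_mem_FP (encodeNat 1))))
    (comp_mem_FP divFn_mem_FP (pairFn_mem_FP (comp_mem_FP addFn_mem_FP (pairFn_mem_FP sndP_mem_FP (const_mem_FP (encodeNat 1))))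
      (const_mem_FP (encodeNat 2)))))) sndP_mem_FP))) _ fun u => by
    change _ ↔ bitsToNat ((remFn ∘ pairFn (prodFn ∘ pairFn (addFn ∘ pairFn fstP (fun _ => encodeNat 1))
      (divFn ∘ pairFn (addFn ∘ pairFn sndP (fun _ => encodeNat 1)) (fun _ => encodeNat 2))) sndP) (fstP u)) = bitsToNat (sndP u)
    simp only [Function.comp_apply, pairFn_apply, remFn_boolPair, prodFn_boolPair, addFn_boolPair, divFn_boolPair, bitsToNat_encodeNat]
    rfl

/-- The range test `1 ≤ val (sndP r) ≤ 2^{t(|w|)+1}` on `r = ⟨⟨w, x⟩, bin b⟩` is a `CH` (indeed `P`) language. [folklore] -/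
theorem blockIndexRange_mem_CH :
    ({r | 1 ≤ bitsToNat (sndP r) ∧ bitsToNat (sndP r) ≤ 2 ^ (t.eval (fstP (fstP r)).length + 1)} : Language Bool) ∈ CH := by
  have hNB : (fun w => Kannan.zerosFn (polyFn (t + 1) w) ++ [true]) ∘ fstP ∘ fstP ∈ FP :=
    comp_mem_FP (pow2LenFn_mem_FP (t + 1)) (comp_mem_FP fstP_mem_FP fstP_mem_FP)
  have hC1 : (pairFn (fun _ => encodeNat 1) sndP ⁻¹' ({u | bitsToNat (fstP u) ≤ bitsToNat (sndP u)} : Language Bool)) ∈ Classes.P :=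
    preimage_mem_P leVal_mem_P (pairFn_mem_FP (const_mem_FP _) sndP_mem_FP)
  have hC2 : (pairFn sndP ((fun w => Kannan.zerosFn (polyFn (t + 1) w) ++ [true]) ∘ fstP ∘ fstP) ⁻¹'
      ({u | bitsToNat (fstP u) ≤ bitsToNat (sndP u)} : Language Bool)) ∈ Classes.P :=
    preimage_mem_P leVal_mem_P (pairFn_mem_FP sndP_mem_FP hNB)
  refine mem_CH_of_iff (P_subset_CH (inter_mem_P hC1 hC2)) _ fun r => ?_
  rw [memL_inf']
  change _ ↔ bitsToNat (fstP (pairFn (fun _ => encodeNat 1) sndP r)) ≤ bitsToNat (sndP (pairFn (fun _ => encodeNat 1) sndP r)) ∧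
    bitsToNat (fstP (pairFn sndP ((fun w => Kannan.zerosFn (polyFn (t + 1) w) ++ [true]) ∘ fstP ∘ fstP) r)) ≤
      bitsToNat (sndP (pairFn sndP ((fun w => Kannan.zerosFn (polyFn (t + 1) w) ++ [true]) ∘ fstP ∘ fstP) r))
  simp only [pairFn_apply, Function.comp_apply, fstP_boolPair, sndP_boolPair, bitsToNat_encodeNat, bitsToNat_pow2LenFn,
    eval_add, eval_one]
  exact Iff.rfl

/-- **The half-successor factor family has a `CH` graph**: given the block-residue function `A`
(`exists_blockRes`), on `r = ⟨⟨w, x⟩, bin b⟩` the factor `((A ⟨⟨w, bin b⟩, x⟩) + 1) · ((val x + 1)/2) mod val x`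
for `1 ≤ b ≤ 2^{L+1}` (and `1` otherwise) has a `CH` graph. [cite: HesseAllenderBarrington2002, Theorem 4.1] -/
theorem halfSuccFactorGraph_mem_CH {A : List Bool → ℕ} (hA : {z | A (fstP z) = bitsToNat (sndP z)} ∈ CH)
    (hAb : ∀ u, A u < 2 ^ (X : Polynomial ℕ).eval u.length) :
    {z | (fun r => if 1 ≤ bitsToNat (sndP r) ∧ bitsToNat (sndP r) ≤ 2 ^ (t.eval (fstP (fstP r)).length + 1) then
          (A (boolPair (boolPair (fstP (fstP r)) (sndP r)) (sndP (fstP r))) + 1) * ((bitsToNat (sndP (fstP r)) + 1) / 2) %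
            bitsToNat (sndP (fstP r))
        else 1) (fstP z) = bitsToNat (sndP z)} ∈ CH := by
  -- the block residue read on the recoded record `⟨⟨w, bin b⟩, x⟩`
  have hrec : pairFn (pairFn (fstP ∘ fstP) sndP) (sndP ∘ fstP) ∈ FP :=
    pairFn_mem_FP (pairFn_mem_FP (comp_mem_FP fstP_mem_FP fstP_mem_FP) sndP_mem_FP) (comp_mem_FP sndP_mem_FP fstP_mem_FP)
  obtain ⟨s, hs⟩ := exists_poly_length_le_of_mem_FP hrec
  have hA' := graph_comp_FP_mem_CH hA hrec
  have hAb' := bound_comp_FP hAb hs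
  -- the modulus reader `val x` on `⟨⟨w, x⟩, bin b⟩`
  have hm : {z | bitsToNat (sndP (fstP (fstP z))) = bitsToNat (sndP z)} ∈ CH :=
    mem_CH_of_iff (P_subset_CH (preimage_mem_P eqVal_mem_P (pairFn_mem_FP (comp_mem_FP sndP_mem_FP (comp_mem_FP fstP_mem_FP fstP_mem_FP))
      sndP_mem_FP))) _ fun z => by
      change _ ↔ bitsToNat (fstP (pairFn (sndP ∘ fstP ∘ fstP) sndP z)) = bitsToNat (sndP (pairFn (sndP ∘ fstP ∘ fstP) sndP z))
      rw [pairFn_apply, fstP_boolPair, sndP_boolPair]; rfl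
  have hmb : ∀ r : List Bool, bitsToNat (sndP (fstP r)) < 2 ^ (X : Polynomial ℕ).eval r.length := fun r => by
    rw [eval_X]
    refine (bitsToNat_lt _).trans_le (Nat.pow_le_pow_right (by norm_num) ?_)
    have a := length_fstF_sndF_le r
    have b := length_fstF_sndF_le (fstP r)
    change 2 * (fstP r).length + (sndP r).length ≤ _ at a
    change 2 * (fstP (fstP r)).length + (sndP (fstP r)).length ≤ _ at b
    omega
  have hThen := comp₂_graph_mem_CH (op := fun a m => (a + 1) * ((m + 1) / 2) % m) (P_subset_CH halfSuccOpGraph_mem_P)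
    hA' hAb' (f₂ := fun r => bitsToNat (sndP (fstP r))) hm hmb
  have hThen' : {z | (fun r => (A (boolPair (boolPair (fstP (fstP r)) (sndP r)) (sndP (fstP r))) + 1) *
      ((bitsToNat (sndP (fstP r)) + 1) / 2) % bitsToNat (sndP (fstP r))) (fstP z) = bitsToNat (sndP z)} ∈ CH :=
    mem_CH_of_iff hThen _ fun z => by
      change _ ↔ (A (pairFn (pairFn (fstP ∘ fstP) sndP) (sndP ∘ fstP) (fstP z)) + 1) * _ % _ = _
      simp only [pairFn_apply, Function.comp_apply]
      exact Iff.rfl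
  exact iteGraph_mem_CH' (blockIndexRange_mem_CH t)
    (f := fun r => (A (boolPair (boolPair (fstP (fstP r)) (sndP r)) (sndP (fstP r))) + 1) *
      ((bitsToNat (sndP (fstP r)) + 1) / 2) % bitsToNat (sndP (fstP r)))
    (g := fun _ => 1) hThen' (constGraph_mem_CH 1)

/-- The half-successor factor is below `2^{|r|}` (it is below the modulus `val x`, or `1`). [folklore] -/
theorem halfSuccFactor_lt_two_pow (A : List Bool → ℕ) (r : List Bool) :
    (if 1 ≤ bitsToNat (sndP r) ∧ bitsToNat (sndP r) ≤ 2 ^ (t.eval (fstP (fstP r)).length + 1) then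
        (A (boolPair (boolPair (fstP (fstP r)) (sndP r)) (sndP (fstP r))) + 1) * ((bitsToNat (sndP (fstP r)) + 1) / 2) %
          bitsToNat (sndP (fstP r))
      else 1) < 2 ^ (X + 1 : Polynomial ℕ).eval r.length := by
  rw [eval_add, eval_X, eval_one, pow_succ (2 : ℕ) r.length]
  have h2 : 1 ≤ 2 ^ r.length := Nat.one_le_two_pow
  have hm : bitsToNat (sndP (fstP r)) < 2 ^ r.length := (bitsToNat_lt _).trans_le (Nat.pow_le_pow_right (by norm_num) (by
    have a := length_fstF_sndF_le r
    have b := length_fstF_sndF_le (fstP r)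
    change 2 * (fstP r).length + (sndP r).length ≤ _ at a
    change 2 * (fstP (fstP r)).length + (sndP (fstP r)).length ≤ _ at b
    omega))
  split_ifs with h
  · rcases Nat.eq_zero_or_pos (bitsToNat (sndP (fstP r))) with h0 | h0
    · rw [h0, Nat.mod_zero]; simp
    · exact (Nat.mod_lt _ h0).trans (by omega)
  · omega

/-- **The congruence behind the half-successor factors**: for an odd prime `q` and an odd `A`,
`((A mod q) + 1) · ((q + 1)/2) ≡ (A + 1)/2 (mod q)` (multiply by `2`, which is invertible). [folklore] -/
theorem halfSucc_mod_eq {q A : ℕ} (hq : q.Prime) (hq2 : q % 2 = 1) (hA : A % 2 = 1) :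
    (A % q + 1) * ((q + 1) / 2) % q = (A + 1) / 2 % q := by
  have hcop : Nat.Coprime 2 q := (Nat.coprime_primes Nat.prime_two hq).2 (by intro h; subst h; simp at hq2)
  have h2q : 2 * ((q + 1) / 2) = q + 1 := by omega
  have h2A : 2 * ((A + 1) / 2) = A + 1 := by omega
  have key : 2 * ((A % q + 1) * ((q + 1) / 2)) ≡ 2 * ((A + 1) / 2) [MOD q] := by
    rw [h2A, mul_left_comm, h2q]
    calc (A % q + 1) * (q + 1) ≡ (A % q + 1) * 1 [MOD q] :=
          (Nat.ModEq.refl _).mul (by simp [Nat.ModEq])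
      _ = A % q + 1 := mul_one _
      _ ≡ A + 1 [MOD q] := (Nat.mod_modEq _ _).add_right _
  exact Nat.ModEq.cancel_left_of_coprime (by simpa using hcop.symm) key

/-- **The residues of `∏_b (A_b+1)/2` are `CH`-definable**: there is a function `Pp` on records
`⟨⟨w, x⟩, μ⟩` with a `CH` graph, below `2^{|·|}`, such that for an odd prime `val x`,
`Pp ⟨⟨w, x⟩, x⟩ = (∏_{i < 2^{L+1}} (A_{i+1} + 1)/2) mod val x` (HAB 2002, proof of Thm. 4.1: "we can
compute the integer `(1 + Aᵢ)/2` in `CRR_P`"). [cite: HesseAllenderBarrington2002, Theorem 4.1] -/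
theorem exists_halfSuccRes :
    ∃ Pp : List Bool → ℕ, {z | Pp (fstP z) = bitsToNat (sndP z)} ∈ CH ∧ (∀ u, Pp u < 2 ^ (X : Polynomial ℕ).eval u.length) ∧
      ∀ (w x : List Bool), (bitsToNat x).Prime → bitsToNat x % 2 = 1 →
        Pp (boolPair (boolPair w x) x) =
          (∏ i ∈ range (2 ^ (t.eval w.length + 1)),
            ((∏ q ∈ (Ico ((i + 1) * 2 ^ (t.eval w.length + 2)) ((i + 2) * 2 ^ (t.eval w.length + 2))).image (Nat.nth Nat.Prime), q) + 1) / 2) %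
            bitsToNat x := by
  obtain ⟨A, hA, hAb, hAeq⟩ := exists_blockRes t
  refine ⟨fun u => if (bitsToNat (sndP u)).Prime then
      (∏ k ∈ range (2 ^ (t + 2 : Polynomial ℕ).eval (fstP u).length),
        (fun r => if 1 ≤ bitsToNat (sndP r) ∧ bitsToNat (sndP r) ≤ 2 ^ (t.eval (fstP (fstP r)).length + 1) then
            (A (boolPair (boolPair (fstP (fstP r)) (sndP r)) (sndP (fstP r))) + 1) * ((bitsToNat (sndP (fstP r)) + 1) / 2) %
              bitsToNat (sndP (fstP r))
          else 1) (boolPair (fstP u) (encodeNat k))) % bitsToNat (sndP u) else 0,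
    iterProdModGraph_mem_CH (t + 2)
      (a := fun r => if 1 ≤ bitsToNat (sndP r) ∧ bitsToNat (sndP r) ≤ 2 ^ (t.eval (fstP (fstP r)).length + 1) then
            (A (boolPair (boolPair (fstP (fstP r)) (sndP r)) (sndP (fstP r))) + 1) * ((bitsToNat (sndP (fstP r)) + 1) / 2) %
              bitsToNat (sndP (fstP r))
          else 1)
      (halfSuccFactorGraph_mem_CH t hA hAb) (halfSuccFactor_lt_two_pow t A),
    fun u => iteModRes_lt_two_pow (fun u => ∏ k ∈ range (2 ^ (t + 2 : Polynomial ℕ).eval (fstP u).length),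
        (fun r => if 1 ≤ bitsToNat (sndP r) ∧ bitsToNat (sndP r) ≤ 2 ^ (t.eval (fstP (fstP r)).length + 1) then
            (A (boolPair (boolPair (fstP (fstP r)) (sndP r)) (sndP (fstP r))) + 1) * ((bitsToNat (sndP (fstP r)) + 1) / 2) %
              bitsToNat (sndP (fstP r))
          else 1) (boolPair (fstP u) (encodeNat k))) u, fun w x hx hx2 => ?_⟩
  simp only [fstP_boolPair, sndP_boolPair, bitsToNat_encodeNat]
  rw [if_pos hx, ← prod_filter]
  -- the range filter is `Icc 1 NB = image (·+1) (range NB)`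
  have hNB : 2 ^ (t.eval w.length + 1) < 2 ^ (t + 2 : Polynomial ℕ).eval (boolPair w x).length := by
    refine Nat.pow_lt_pow_right (by norm_num) ?_
    rw [eval_add, eval_ofNat]
    have := TM2Iter.eval_mono t (show w.length ≤ (boolPair w x).length by rw [length_boolPair]; omega)
    omega
  have hset : (range (2 ^ (t + 2 : Polynomial ℕ).eval (boolPair w x).length)).filter
      (fun b => 1 ≤ b ∧ b ≤ 2 ^ (t.eval w.length + 1)) = (range (2 ^ (t.eval w.length + 1))).image (· + 1) := by
    ext b
    simp only [mem_filter, mem_range, mem_image]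
    constructor
    · rintro ⟨-, h1, h2⟩; exact ⟨b - 1, by omega, by omega⟩
    · rintro ⟨i, hi, rfl⟩; exact ⟨by omega, by omega, by omega⟩
  rw [hset, prod_image fun a _ b _ h => by simpa using h, prod_nat_mod, prod_congr rfl fun i hi => ?_, ← prod_nat_mod]
  -- each factor: `((A_{i+1} mod q) + 1) (q+1)/2 ≡ (A_{i+1} + 1)/2 (mod q)`
  rw [hAeq w x (i + 1) (by have := mem_range.1 hi; omega) hx, show i + 1 + 1 = i + 2 by ring,
    halfSucc_mod_eq hx hx2 ?_, Nat.mod_mod]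
  -- the block is a product of odd primes (its index range starts at `(i+1) K' ≥ 1`)
  rw [prod_nat_mod, prod_congr rfl fun q hq => (prime_and_odd_of_mem_image_nth
    (Nat.succ_le_of_lt (Nat.mul_pos (Nat.succ_pos i) (Nat.two_pow_pos _))) hq).2, prod_const_one]
  decide

end Blocks

end Literature.Computability.Complexity
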